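import Literature.NumberTheory.GaloisCohomology.Howard2004.DVRSettingPiRefinementConclusion
import Literature.NumberTheory.GaloisCohomology.Howard2004.DVRSettingPiRefinementKolyvaginSystem
import Literature.NumberTheory.GaloisCohomology.Howard2004.TameWLOGProofs
import HarnessLib

/-!
# Howard 2004, Thm. 1.6.1 for a general `DVRSetting` from Thm. 1.6.1 on FULL, TAME-PINNED settings
# (the composition of the refinement programme; theorems only)

B. Howard, *The Heegner point Kolyvagin system*, Compositio Math. **140** (2004) (arXiv:1202.6340), Thm. 1.6.1
(arXiv Thm. 2.6.1, p. 11 L23–28) and the first lines of its proof (p. 11 L33–38, p. 12 L29–33): «`R^{(k)} = R/𝔪^k`,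
`T^{(k)} = T/𝔪^k T` … By Remark 1.3.1 the Selmer triple `(T^{(k)}, F, 𝓛^{(k)})` satisfies hypotheses H.0–H.5» —
Howard works with the FULL tower of levels `T/π^{i+1}T`, whereas the tree's `DVRSetting` allows any cofinal family
of exponents `e_k` and any admissible finite–singular slots.  The refinement programme of the cell `pub/bsd-print-x9`
(REFINE R1–R8, R7-KS♯, TAME-WLOG, COFINAL) reduces the typed fact `thm161_dvrKolyvaginBound` to its instance on full,
tame-pinned settings; this file is the COMPOSITION step:

* §1 **`DVRSetting.conclusion_of_full_of_refinedKS`** — for a setting `S` with H.0–H.5, `𝓛_s ⊂ 𝓛` for `s ≫ 0`, a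
  Kolyvagin system `κ` with `κ_1 ≠ 0`, a pin family `pins`, and a Kolyvagin system `κ♯` of the refined setting
  `S.refine hy pins` (R6b, `DVRSettingPiRefinementAssembly`) whose bottom class is the refined family of `κ_1`
  (R7-TOWER♯ `refinedFamily`): IF Thm. 1.6.1 holds for every FULL (`e_i = i + 1`), TAME-PINNED
  (`fs = tameSlotOn pins …`) setting (hypothesis `H`, stated with the binder list of `thm161_dvrKolyvaginBound` /
  `thm161_of_forall_tame` verbatim plus the fullness clause), THEN `S.Conclusion hy κ.one`.  Proof: `H` at
  `S.refine hy pins` (full by `rfl`, tame-pinned by `refinedLD_fs`, `𝓛_s ⊂ 𝓛` by `refine_largePrimes_iff`, `κ♯_1 ≠ 0` by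
  `eq_zero_of_refinedFamily_eq_zero`), then R8 `conclusion_of_refine` (the (COFINAL) transfer back along
  `T^{(k)} ≅ T/π^{e_k}T`);
* §2 **`DVRSetting.conclusion_of_full_of_tame`** — the same for a TAME-PINNED `S`, with `κ♯` the refined Kolyvagin system
  `refinePushforward` of R7-KS♯ (`DVRSettingPiRefinementKolyvaginSystem`; bottom class `= refinedFamily κ_1` by
  `refinePushforward_one_eq_refinedFamily`);
* §3 **`DVRSetting.thm161_of_full_tame`** — `thm161_dvrKolyvaginBound` from its instance on FULL, TAME-PINNED settings:
  TAME-WLOG `thm161_of_forall_tame` (`TameWLOGProofs`) composed with §2.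

THEOREMS ONLY: no definition, no named fact, no instance, no notation, no `sorry`.  What is NOT here — and what the
hypothesis of §3 still asks for — is Thm. 1.6.1 ON FULL TAME-PINNED SETTINGS (Lemma 1.6.4 via the engine
`StubLemmaInductionProofs`, the levelwise structure Thm. 1.4.2 / Prop. 1.4.1, Prop. 1.5.9, Lemma 1.6.2, …).
`thm161_dvrKolyvaginBound` is NOT proved; no summit statement is proved; BSD is not proved by any of this.
-/

set_option autoImplicit false

noncomputable section

open Function NumberField IsDedekindDomain Field
open scoped NumberField ContRepresentation Classical

namespace Literature.NumberTheory.GaloisCohomology.Howard2004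

open Literature.NumberTheory.GaloisRepresentations
open Literature.NumberTheory.GaloisRepresentations.DiscreteGaloisModule

namespace DVRSetting

variable {p : ℕ} [Fact p.Prime] {K : Type} [Field K] [NumberField K]
  {R : Type} [CommRing R] [IsDomain R] [IsDiscreteValuationRing R] [Algebra ℤ_[p] R]
  {N : ℕ → Type} [∀ k, AddCommGroup (N k)] [∀ k, TopologicalSpace (N k)]
  [∀ k, DiscreteTopology (N k)] [∀ k, Module R (N k)]
  {Rk : ℕ → Type} [∀ k, CommRing (Rk k)] [∀ k, IsLocalRing (Rk k)] [∀ k, TopologicalSpace (Rk k)]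
  [∀ k, DiscreteTopology (Rk k)] [∀ k, Algebra ℤ_[p] (Rk k)] [∀ k, Algebra R (Rk k)]
  [∀ k, Module (Rk k) (N k)] [∀ k, IsScalarTower R (Rk k) (N k)]
  {Nbar : Type} [AddCommGroup Nbar] [TopologicalSpace Nbar] [DiscreteTopology Nbar]
  [∀ k, Module (Rk k) Nbar]
  {Nq : ℕ → Finset (HeightOneSpectrum (𝓞 K)) → Type} [∀ k n, AddCommGroup (Nq k n)]
  [∀ k n, TopologicalSpace (Nq k n)] [∀ k n, DiscreteTopology (Nq k n)]
  [∀ k n, Module (Rk k) (Nq k n)] [∀ k n, Module R (Nq k n)]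
  [∀ k n, IsScalarTower R (Rk k) (Nq k n)]

/-! ## §1 The conclusion for `S` from Thm. 1.6.1 on full, tame-pinned settings and a refined Kolyvagin system -/

/-- **Thm. 1.6.1 for `S` from Thm. 1.6.1 on FULL, TAME-PINNED settings**, given a Kolyvagin system `κ♯` of the
refined setting `S.refine hy pins` with bottom class `refinedFamily κ_1`: the hypothesis `H` is
`thm161_dvrKolyvaginBound` restricted to settings with `e_i = i + 1` whose finite–singular slots are the guarded tame
slots of a pin family; it is applied to `S.refine hy pins` (full by construction, tame-pinned by `refinedLD_fs`,
`𝓛_s ⊂ 𝓛` transferred by `refine_largePrimes_iff`, `κ♯_1 ≠ 0` by `eq_zero_of_refinedFamily_eq_zero`), and the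
conclusion is carried back to `S` by `conclusion_of_refine` (the cofinal embedding `T^{(k)} ≅ T/π^{e_k}T`).
[cite: Howard2004HeegnerKolyvagin, Thm. 1.6.1 and its proof (arXiv Thm. 2.6.1, p. 11 L23–28, L33–38; p. 12 L29–33), Rem. 1.3.1 (p. 7 L125–127)] -/
theorem conclusion_of_full_of_refinedKS (S : DVRSetting p K R N Rk Nbar Nq) (hy : S.SatisfiesH)
    (pins : ∀ v : HeightOneSpectrum (𝓞 K), TamePin v) (κ : S.KolyvaginSystem) (hL : S.LargePrimes)
    (hone : κ.one ≠ 0)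
    (κr : letI : ∀ i, TopologicalSpace (S.QuotRing (i + 1)) := fun i => S.refineInstTop i
      haveI : ∀ i, DiscreteTopology (S.QuotRing (i + 1)) := fun i => S.refineInst_discrete i
      haveI : ∀ i, IsLocalRing (S.QuotRing (i + 1)) := fun i => S.refineInst_isLocalRing hy i
      letI : ∀ i, Module (S.QuotRing (i + 1)) Nbar := fun i => S.residualModule hy i
      (S.refine hy pins).KolyvaginSystem)
    (hκr : letI : ∀ i, TopologicalSpace (S.QuotRing (i + 1)) := fun i => S.refineInstTop i
      haveI : ∀ i, DiscreteTopology (S.QuotRing (i + 1)) := fun i => S.refineInst_discrete i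
      haveI : ∀ i, IsLocalRing (S.QuotRing (i + 1)) := fun i => S.refineInst_isLocalRing hy i
      letI : ∀ i, Module (S.QuotRing (i + 1)) Nbar := fun i => S.residualModule hy i
      κr.one = S.refinedFamily hy κ.one)
    (H : ∀ (N' : ℕ → Type) [∀ k, AddCommGroup (N' k)] [∀ k, TopologicalSpace (N' k)]
      [∀ k, DiscreteTopology (N' k)] [∀ k, Module R (N' k)]
      (Rk' : ℕ → Type) [∀ k, CommRing (Rk' k)] [∀ k, IsLocalRing (Rk' k)] [∀ k, TopologicalSpace (Rk' k)]
      [∀ k, DiscreteTopology (Rk' k)] [∀ k, Algebra ℤ_[p] (Rk' k)] [∀ k, Algebra R (Rk' k)]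
      [∀ k, Module (Rk' k) (N' k)] [∀ k, IsScalarTower R (Rk' k) (N' k)]
      (Nbar' : Type) [AddCommGroup Nbar'] [TopologicalSpace Nbar'] [DiscreteTopology Nbar']
      [∀ k, Module (Rk' k) Nbar']
      (Nq' : ℕ → Finset (HeightOneSpectrum (𝓞 K)) → Type) [∀ k n, AddCommGroup (Nq' k n)]
      [∀ k n, TopologicalSpace (Nq' k n)] [∀ k n, DiscreteTopology (Nq' k n)]
      [∀ k n, Module (Rk' k) (Nq' k n)] [∀ k n, Module R (Nq' k n)]
      [∀ k n, IsScalarTower R (Rk' k) (Nq' k n)] [∀ k n, Finite (Nq' k n)]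
      (S' : DVRSetting p K R N' Rk' Nbar' Nq') (κ' : S'.KolyvaginSystem) (hy' : S'.SatisfiesH)
      (pins' : ∀ v : HeightOneSpectrum (𝓞 K), TamePin v)
      (hP' : ∀ k n v, n ∈ levels S'.L ∧ v ∈ n → TameHyp (S'.LD k).ρq n v),
      (∀ i, S'.e i = i + 1) →
      (∀ k, (S'.LD k).fs = tameSlotOn pins' (S'.LD k).ρq (fun n v => n ∈ levels S'.L ∧ v ∈ n) (hP' k)) →
      S'.LargePrimes → κ'.one ≠ 0 → S'.Conclusion hy' κ'.one) :
    S.Conclusion hy κ.one := by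
  letI : ∀ i, TopologicalSpace (S.QuotRing (i + 1)) := fun i => S.refineInstTop i
  haveI : ∀ i, DiscreteTopology (S.QuotRing (i + 1)) := fun i => S.refineInst_discrete i
  haveI : ∀ i, IsLocalRing (S.QuotRing (i + 1)) := fun i => S.refineInst_isLocalRing hy i
  letI : ∀ i, Module (S.QuotRing (i + 1)) Nbar := fun i => S.residualModule hy i
  haveI : ∀ i n, Finite (LevelData.QuotCarrier (S.QuotRing (i + 1)) (S.refinedRep hy i) n) :=
    fun i n => S.finite_refinedQuotCarrier hy i n
  have hone1 : κ.one ∈ S.T.limitH1 := (AddSubgroup.mem_inf.mp κ.one_mem).1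
  have honer : κr.one ≠ 0 := by
    intro h0
    rw [hκr] at h0
    exact hone (S.eq_zero_of_refinedFamily_eq_zero hy hone1 h0)
  have hconc := H (fun i => S.refinedCarrier hy i) (fun i => S.QuotRing (i + 1)) Nbar
    (fun i n => LevelData.QuotCarrier (S.QuotRing (i + 1)) (S.refinedRep hy i) n)
    (S.refine hy pins) κr (S.refine_satisfiesH hy pins) pins (fun i => S.tameHyp_refined hy i)
    (fun _ => rfl) (fun _ => rfl) ((S.refine_largePrimes_iff hy pins).mpr hL) honer
  rw [hκr] at hconc
  exact S.conclusion_of_refine hy pins κ hconc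

/-! ## §2 The conclusion for a tame-pinned `S` from Thm. 1.6.1 on full, tame-pinned settings -/

/-- **Thm. 1.6.1 for a TAME-PINNED `S` from Thm. 1.6.1 on FULL, TAME-PINNED settings**: §1 with `κ♯` the refined
Kolyvagin system `refinePushforward` of `κ` («we obtain, by Remark (functorality), a Kolyvagin system `κ^{(k)}`»), whose
bottom class is `refinedFamily κ_1` (`refinePushforward_one_eq_refinedFamily`).
[cite: Howard2004HeegnerKolyvagin, Thm. 1.6.1 and its proof (arXiv Thm. 2.6.1, p. 11 L23–28, L33–47; p. 12 L29–33), Rem. 1.2.4 (p. 7 L13–27), Rem. 1.3.1 (p. 7 L125–127)] -/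
theorem conclusion_of_full_of_tame (S : DVRSetting p K R N Rk Nbar Nq) (hy : S.SatisfiesH)
    (pins : ∀ v : HeightOneSpectrum (𝓞 K), TamePin v) [∀ k n, Finite (Nq k n)]
    (hPS : ∀ k n v, n ∈ levels S.L ∧ v ∈ n → TameHyp (S.LD k).ρq n v)
    (htame : ∀ k, (S.LD k).fs = tameSlotOn pins (S.LD k).ρq (fun n v => n ∈ levels S.L ∧ v ∈ n) (hPS k))
    (κ : S.KolyvaginSystem) (hL : S.LargePrimes) (hone : κ.one ≠ 0)
    (H : ∀ (N' : ℕ → Type) [∀ k, AddCommGroup (N' k)] [∀ k, TopologicalSpace (N' k)]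
      [∀ k, DiscreteTopology (N' k)] [∀ k, Module R (N' k)]
      (Rk' : ℕ → Type) [∀ k, CommRing (Rk' k)] [∀ k, IsLocalRing (Rk' k)] [∀ k, TopologicalSpace (Rk' k)]
      [∀ k, DiscreteTopology (Rk' k)] [∀ k, Algebra ℤ_[p] (Rk' k)] [∀ k, Algebra R (Rk' k)]
      [∀ k, Module (Rk' k) (N' k)] [∀ k, IsScalarTower R (Rk' k) (N' k)]
      (Nbar' : Type) [AddCommGroup Nbar'] [TopologicalSpace Nbar'] [DiscreteTopology Nbar']
      [∀ k, Module (Rk' k) Nbar']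
      (Nq' : ℕ → Finset (HeightOneSpectrum (𝓞 K)) → Type) [∀ k n, AddCommGroup (Nq' k n)]
      [∀ k n, TopologicalSpace (Nq' k n)] [∀ k n, DiscreteTopology (Nq' k n)]
      [∀ k n, Module (Rk' k) (Nq' k n)] [∀ k n, Module R (Nq' k n)]
      [∀ k n, IsScalarTower R (Rk' k) (Nq' k n)] [∀ k n, Finite (Nq' k n)]
      (S' : DVRSetting p K R N' Rk' Nbar' Nq') (κ' : S'.KolyvaginSystem) (hy' : S'.SatisfiesH)
      (pins' : ∀ v : HeightOneSpectrum (𝓞 K), TamePin v)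
      (hP' : ∀ k n v, n ∈ levels S'.L ∧ v ∈ n → TameHyp (S'.LD k).ρq n v),
      (∀ i, S'.e i = i + 1) →
      (∀ k, (S'.LD k).fs = tameSlotOn pins' (S'.LD k).ρq (fun n v => n ∈ levels S'.L ∧ v ∈ n) (hP' k)) →
      S'.LargePrimes → κ'.one ≠ 0 → S'.Conclusion hy' κ'.one) :
    S.Conclusion hy κ.one :=
  S.conclusion_of_full_of_refinedKS hy pins κ hL hone (S.refinePushforward hy pins hPS htame κ)
    (S.refinePushforward_one_eq_refinedFamily hy pins hPS htame κ) H

/-! ## §3 `thm161_dvrKolyvaginBound` from Thm. 1.6.1 on full, tame-pinned settings -/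

/-- **Howard's Thm. 1.6.1 as typed (`thm161_dvrKolyvaginBound`: every `DVRSetting` with H.0–H.5, any cofinal exponents
`e_k`, any admissible finite–singular slots) from Thm. 1.6.1 on FULL (`e_i = i + 1`), TAME-PINNED settings** — the
shape in which Howard states and proves it («`T^{(k)} = T/𝔪^kT` … By Remark 1.3.1 the Selmer triple `(T^{(k)}, F, 𝓛^{(k)})`
satisfies hypotheses H.0–H.5»): the tame WLOG `thm161_of_forall_tame` (levelwise unit rescaling of the slots) composed
with §2 (the `π`-adic refinement `S.refine` and the cofinal transfer of the conclusion).  The hypothesis keeps the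
binder list of `thm161_of_forall_tame` verbatim and adds the fullness clause `∀ i, S.e i = i + 1` in front.
[cite: Howard2004HeegnerKolyvagin, Thm. 1.6.1 and its proof (arXiv Thm. 2.6.1, p. 11 L23–28, L33–47; p. 12 L29–55), Rem. 1.3.1 (p. 7 L125–127), Def. 1.1.8 / Def. 1.2.3 (p. 5 L144–149, p. 7 L1–12)] -/
theorem thm161_of_full_tame
    (h : ∀ (p : ℕ) [Fact p.Prime] (K : Type) [Field K] [NumberField K]
      (R : Type) [CommRing R] [IsDomain R] [IsDiscreteValuationRing R] [Algebra ℤ_[p] R]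
      (N : ℕ → Type) [∀ k, AddCommGroup (N k)] [∀ k, TopologicalSpace (N k)]
      [∀ k, DiscreteTopology (N k)] [∀ k, Module R (N k)]
      (Rk : ℕ → Type) [∀ k, CommRing (Rk k)] [∀ k, IsLocalRing (Rk k)] [∀ k, TopologicalSpace (Rk k)]
      [∀ k, DiscreteTopology (Rk k)] [∀ k, Algebra ℤ_[p] (Rk k)] [∀ k, Algebra R (Rk k)]
      [∀ k, Module (Rk k) (N k)] [∀ k, IsScalarTower R (Rk k) (N k)]
      (Nbar : Type) [AddCommGroup Nbar] [TopologicalSpace Nbar] [DiscreteTopology Nbar]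
      [∀ k, Module (Rk k) Nbar]
      (Nq : ℕ → Finset (HeightOneSpectrum (𝓞 K)) → Type) [∀ k n, AddCommGroup (Nq k n)]
      [∀ k n, TopologicalSpace (Nq k n)] [∀ k n, DiscreteTopology (Nq k n)]
      [∀ k n, Module (Rk k) (Nq k n)] [∀ k n, Module R (Nq k n)]
      [∀ k n, IsScalarTower R (Rk k) (Nq k n)] [∀ k n, Finite (Nq k n)]
      (S : DVRSetting p K R N Rk Nbar Nq) (κ : S.KolyvaginSystem) (hy : S.SatisfiesH)
      (pins : ∀ v : HeightOneSpectrum (𝓞 K), TamePin v)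
      (hP : ∀ k n v, n ∈ levels S.L ∧ v ∈ n → TameHyp (S.LD k).ρq n v),
      (∀ i, S.e i = i + 1) →
      (∀ k, (S.LD k).fs = tameSlotOn pins (S.LD k).ρq (fun n v => n ∈ levels S.L ∧ v ∈ n) (hP k)) →
      S.LargePrimes → κ.one ≠ 0 → S.Conclusion hy κ.one) :
    thm161_dvrKolyvaginBound := by
  refine thm161_of_forall_tame ?_
  intro p _ K _ _ R _ _ _ _ N _ _ _ _ Rk _ _ _ _ _ _ _ _ Nbar _ _ _ _ Nq _ _ _ _ _ _ _ S κ hy pins hP htame hL hone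
  exact S.conclusion_of_full_of_tame hy pins hP htame κ hL hone (h p K R)

end DVRSetting

end Literature.NumberTheory.GaloisCohomology.Howard2004

end
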